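import Summits.QuantumFields.BalabanUV.T4Continuum.Support.DirichletLocalisedBesov
import Summits.QuantumFields.BalabanUV.T4Continuum.Support.DirichletScalarTowerMonotone
import Summits.QuantumFields.BalabanUV.T4Continuum.Support.DirichletScalarTowerPotential
import Summits.QuantumFields.BalabanUV.T4Continuum.Support.DirichletBesovTwoLevel

/-!
# `BalabanUV.T4Continuum.Support.DirichletSplittableTwoLevel` — NE2 (node U1a) formalisation swarm, SUPPLIER item «Δ1-LOCAL» under the
# owner's sub-row `T4-U1a.S-NE2-D1-DIRICHLET°` (wall `hinj`): THE END — THE DIRICHLET TWO-LEVEL INJECTED LAW FOR THE `U = 1` SCALAR MODEL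
# ON EVERY LOCALLY SPLITTABLE UNION OF UNIT BLOCKS AT THE RATE `√R/√N`, AND ITS SCALAR FREE TOWER AT RATE `(√L)⁻¹`, NO DISPLAYED BINDER
# (unit b2b-balaban-t4-ne2-formalise-leaf-08, gen 5, file 4 of 4)

HONEST FRAMING.  Rung (B)+1 bookkeeping at MODEL level (U = 1 scalar layer `Δ′ = Δ + a′Π′`, King's planting `J₀`), finite torus;
NE2 (U1a) is NOT proved by this file; spine PROVED 0/9 unchanged; NOT infinite volume, NOT the mass gap, NOT Clay.  HONEST DEPENDENCY
(verbatim): «continuum YM on T⁴ ⇐ BetaPertH ∧ nine spine estimates (0/9 proved); BetaPertH ⇐ (D1) ∧ (D4) ∧ CAP+tail; G-an2-4 gates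
asym, D1 and NE2/3/4.»

WHAT THIS FILE PROVES (0 sorry; files 1–3, gan24-p2's compression ∕ pairing modules and the owner's level adapter BY NAME).
 * §1 **`nsq_Pdir_solExt_le_of_splittable`**: on a region `Ω ↔ blockReg n M S` with `S` splittable along `μ` at every vertex, the
   zero-extended Dirichlet solution obeys `‖∂_μᴴ∂_μ (solExt f)‖² ≤ 24·2^d·n·Ks₁·Ks₂·‖f‖²` (file 3's END fed with gan24's energy bounds)
   — ONE power of the lattice factor, the budget of module (III) §1 WITHOUT a cutoff;
 * §2 **THE END `injected_le_of_locallySplittable (hS : LocallySplittable M S) (hN : 1 ≤ N) (hRN : 2 ≤ R·N) (ha′ : 0 < a′) :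
   ‖(D′^{Ω′})⁻¹·J^Ω − J^Ω·(D^Ω)⁻¹‖ ≤ splitConst d a′ · √R / √N`** for `Ω = blockReg N M S` — LITERALLY the shape of gen 3's
   `injected_le_of_locallyMonotone` and of gan24-p2's `injected_le_box`, on the larger class; corollaries `…_of_locallyMonotone'`
   (consistency with gen 3) and **`…_of_monotone_or_pillarFree`** (the checkable criterion of file 1);
 * §3 the TOWER: **`towerLimitRate_dirichletScalar_splittable (hL : 2 ≤ L) (hd) (ha′) (hS : LocallySplittable M S)`** — the
   Ω-restricted unit-lattice scalar free covariances CONVERGE at the rate `(√L)⁻¹` with NO displayed binder (the owner's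
   `towerLimitRate_dirichletScalar_of_sqrt_levels` BY NAME), the `FreeTowerLaws`, the resolvent route, and the criterion form.
 The class `LocallySplittable` contains gen 3's `LocallyMonotone` and gen 4's «all face-components locally monotone», and NEW one-component
 configurations (a face-connected ring of blocks closing on itself through a corner ∕ edge contact: non-monotone at the contact vertex, yet
 pillar-free there).  LOCATED RESIDUE (precise): a vertex patch non-monotone along `μ` whose conflicting blocks are joined by a `μ`-pillar
 INSIDE the patch — the spiral 4-chain of cubes around a vertex (d ≥ 3), intrinsically non-Lipschitz: there no one-sided splitting exists at
 any scale, and the two-level pairing would need the `L²` trace of `∂_μ v` on the exposed faces through the vertex, which the `B^{3/2}_{2,∞}`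
 budget of one-sided translations does not give (a Morrey-type energy decay at the vertex would be a further input).

ABSOLUTE RULE (cell, verbatim): «No internally-minted statement may enter as a cited fact. Every hypothesis is either kernel-proved in
this package or a verbatim quotation of a PUBLISHED theorem with page reference. The manuscript(s) under audit are NOT citable for
their own disputed steps — they are the thing under adjudication; programme-internal (2001/route/tribunal) claims are never citable.»
[folklore] finite-dimensional analysis; no `def … : Prop` fact; the only hypotheses of the ENDs are `LocallySplittable S` (a shape
predicate on the block set), `1 ≤ N`, `2 ≤ R·N` ∕ `2 ≤ L`, `0 < d`, `0 < a′`.  NOT CLAIMED: the spiral 4-chain and kin; rate `N^{−1}`; the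
VECTOR operator `calDalev` ∕ the printed gauge term; NOT [B9] (3.23)–(3.27) as printed; NE2; NE3; «not in print; our proof».
-/

noncomputable section

open scoped BigOperators ComplexConjugate Matrix Matrix.Norms.L2Operator
open Finset

namespace Summit.QuantumFields.BalabanUV.T4Continuum.DirichletSplittableTwoLevel

open Literature.MathematicalPhysics.QuantumFieldTheory.Balaban1983to89.B5Prop11Plancherel (Tor fine unitVec)
open Literature.MathematicalPhysics.QuantumFieldTheory.Balaban1983to89.B5Action121 (sdiff LapS)
open Literature.MathematicalPhysics.QuantumFieldTheory.Balaban1983to89.B5Prop11Lower (nsq nsq_nonneg)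
open Literature.MathematicalPhysics.QuantumFieldTheory.Balaban1983to89.B5Blocks16 (blockOf)
open Literature.MathematicalPhysics.QuantumFieldTheory.Balaban1983to89.B5G183RateUnitTower (lev lev_neZero)
open Summit.QuantumFields.BalabanUV.T4Continuum
open Summit.QuantumFields.BalabanUV.T4Continuum.CovariantAveragingTower (TowerLimitRate)
open Summit.QuantumFields.BalabanUV.T4Continuum.BalabanAveragedTowerUnit (one_le_lev' cast_lev')
open Summit.QuantumFields.BalabanUV.T4Continuum.BackgroundResolventTower
open Summit.QuantumFields.BalabanUV.T4Continuum.ScalarAveragedPropagator (gammaPs gammaPs_pos dirichlet)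
open Summit.QuantumFields.BalabanUV.T4Continuum.DirichletDirectionalBesov (nsqOn)
open Summit.QuantumFields.BalabanUV.T4Continuum.DirichletDirectionalBesovCutoff (energy)
open Summit.QuantumFields.BalabanUV.T4Continuum.DirichletMonotoneCutoff (DownClosed UpClosed LocallyMonotone pred_pos)
open Summit.QuantumFields.BalabanUV.T4Continuum.DirichletSplitPieces (SplittableAt LocallySplittable PillarFree
  locallySplittable_of_locallyMonotone locallySplittable_of_monotone_or_pillarFree)
open Summit.QuantumFields.BalabanUV.T4Continuum.DirichletLocalisedBesov (ell1 ell2 nsq_sdiffH_sdiff_le_of_splittable)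
open Summit.QuantumFields.BalabanUV.T4Continuum.DirichletScalarTower
open Summit.QuantumFields.BalabanUV.T4Continuum.DirichletScalarTowerLevels (injected_regS_le_of_blockReg
  towerLimitRate_dirichletScalar_of_sqrt_levels sqrt_lev invL_le_inv_sqrt inv_sqrt_lt_one)
open Summit.QuantumFields.BalabanUV.T4Continuum.DirichletScalarTowerMonotone (two_le_mul_lev)
open Summit.QuantumFields.BalabanUV.T4Continuum.DirichletScalarTowerPotential (diagS towerLimitRate_dirichletScalar_potential_of_injected)
open Summit.QuantumFields.BalabanUV.T4Continuum.BalabanAveragedTowerModes (par)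
open Summit.QuantumFields.BalabanUV.Beta.GAN24.DirichletBoxRegularity (Pdir)
open Summit.QuantumFields.BalabanUV.Beta.GAN24.DirichletBoxCompression (DOm JOm refineR solExt solExt_apply_of_not form_defect
  nsq_sdiff_solExt_le dirichlet_solExt_le nsq_solExt_le sum_normSq_LapS_solExt_le opNorm_le_of_pairing)
open Summit.QuantumFields.BalabanUV.Beta.GAN24.DirichletBoxPairing (norm_pairing_le)
open Summit.QuantumFields.BalabanUV.Beta.GAN24.DirichletBoxTrace (blockReg)
open Summit.QuantumFields.BalabanUV.Beta.GAN24.DirichletBoxTwoLevelCore (refineR_blockReg_iff)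

variable {d : ℕ}

/-! ## §1 The second-difference budget of the fine Dirichlet solution on a locally splittable region -/

/-- the energy-side constant `Ks₁ = √(2γ′⁻¹ + 72dγ′⁻²)`. [folklore] -/
def Ks1 (d : ℕ) (a' : ℝ) : ℝ := Real.sqrt (2 * (gammaPs d a')⁻¹ + 72 * d * (gammaPs d a')⁻¹ ^ 2)

/-- the datum-side constant `Ks₂ = √(4(1 + (a′γ′⁻¹)²) + 576dγ′⁻¹ + 9216d²γ′⁻²)`. [folklore] -/
def Ks2 (d : ℕ) (a' : ℝ) : ℝ :=
  Real.sqrt (4 * (1 + (a' * (gammaPs d a')⁻¹) ^ 2) + 576 * d * (gammaPs d a')⁻¹ + 9216 * d ^ 2 * (gammaPs d a')⁻¹ ^ 2)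

/-- `Ks₁ ≥ 0`. [folklore] -/
theorem Ks1_nonneg (d : ℕ) (a' : ℝ) : 0 ≤ Ks1 d a' := Real.sqrt_nonneg _

/-- `Ks₂ ≥ 0`. [folklore] -/
theorem Ks2_nonneg (d : ℕ) (a' : ℝ) : 0 ≤ Ks2 d a' := Real.sqrt_nonneg _

/-- the unit-scale bump constants against the lattice factor: `n²ℓ₁² ≤ 36` (`2 ≤ n`). [folklore] -/
theorem sq_mul_ell1_sq_le {n : ℕ} (hn : 2 ≤ n) : (n : ℝ) ^ 2 * ell1 n ^ 2 ≤ 36 := by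
  have hp := pred_pos hn
  have h2 : (2 : ℝ) ≤ n := by exact_mod_cast hn
  have hq : (n : ℝ) * (1 / ((n : ℝ) - 1)) ≤ 2 := by
    rw [mul_one_div, div_le_iff₀ hp]; linarith
  have hq0 : 0 ≤ (n : ℝ) * (1 / ((n : ℝ) - 1)) := by positivity
  calc (n : ℝ) ^ 2 * ell1 n ^ 2 = 9 * ((n : ℝ) * (1 / ((n : ℝ) - 1))) ^ 2 := by rw [ell1]; ring
    _ ≤ 9 * 2 ^ 2 := by gcongr
    _ = 36 := by norm_num

/-- `n⁴ℓ₂² ≤ 2304` (`2 ≤ n`). [folklore] -/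
theorem pow4_mul_ell2_sq_le {n : ℕ} (hn : 2 ≤ n) : (n : ℝ) ^ 4 * ell2 n ^ 2 ≤ 2304 := by
  have hp := pred_pos hn
  have h2 : (2 : ℝ) ≤ n := by exact_mod_cast hn
  have hq : (n : ℝ) * (1 / ((n : ℝ) - 1)) ≤ 2 := by
    rw [mul_one_div, div_le_iff₀ hp]; linarith
  have hq0 : 0 ≤ (n : ℝ) * (1 / ((n : ℝ) - 1)) := by positivity
  calc (n : ℝ) ^ 4 * ell2 n ^ 2 = 144 * ((n : ℝ) * (1 / ((n : ℝ) - 1))) ^ 4 := by rw [ell2]; ring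
    _ ≤ 144 * 2 ^ 4 := by gcongr
    _ = 2304 := by norm_num

section OneLevel

variable (n : ℕ) [NeZero n] (M : Fin d → ℕ) [hM : ∀ μ, NeZero (M μ)] (a' : ℝ) (Ω : Tor (fine n M) → Prop) [DecidablePred Ω]

/-- **THE SECOND-DIFFERENCE BUDGET WITHOUT A CUTOFF**: if `Ω` is (pointwise) the block region of a block set `S` splittable along `μ`
at every vertex (`2 ≤ n`, `0 < a′`), the zero-extended Dirichlet solution `u = solExt f` obeys `‖∂_μᴴ∂_μ u‖² ≤ 24·2^d·n·Ks₁·Ks₂·‖f‖²`.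
[folklore] -/
theorem nsq_Pdir_solExt_le_of_splittable (hn : 2 ≤ n) (ha' : 0 < a') {S : Tor M → Prop} (hΩ : ∀ x, Ω x ↔ S (blockOf n M x))
    {μ : Fin d} (hS : ∀ v : Tor M, SplittableAt M S v μ) (f : {x // Ω x} → ℂ) :
    nsq (Pdir (fine n M) (n : ℂ) μ *ᵥ solExt n M a' Ω f) ≤ 24 * 2 ^ d * n * Ks1 d a' * Ks2 d a' * nsq f := by
  have hγ := (gammaPs_pos (d := d) (a' := a')).1
  have hc : ((n : ℕ) : ℂ) ≠ 0 := by exact_mod_cast NeZero.ne n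
  set u := solExt n M a' Ω f with hu
  have hz : ∀ x, ¬ Ω x → u x = 0 := fun x hx => solExt_apply_of_not n M a' Ω f hx
  have hmain := nsq_sdiffH_sdiff_le_of_splittable n M hn hΩ hS ((n : ℕ) : ℂ) hc hz
  rw [Pdir, ← Matrix.mulVec_mulVec]
  refine hmain.trans ?_
  rw [Complex.norm_natCast]
  set W := nsq f with hW
  have hW0 : 0 ≤ W := nsq_nonneg f
  have hE : energy (fine n M) ((n : ℕ) : ℂ) u ≤ (gammaPs d a')⁻¹ * W := dirichlet_solExt_le n M a' Ω ha' f
  have hZ : nsq u ≤ (gammaPs d a')⁻¹ ^ 2 * W := nsq_solExt_le n M a' Ω ha' f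
  have hG : nsqOn Ω (LapS (fine n M) ((n : ℕ) : ℂ) *ᵥ u) ≤ 2 * (1 + (a' * (gammaPs d a')⁻¹) ^ 2) * W :=
    sum_normSq_LapS_solExt_le n M a' Ω ha' f
  have hE0 : 0 ≤ energy (fine n M) ((n : ℕ) : ℂ) u := Finset.sum_nonneg fun _ _ => nsq_nonneg _
  have hZ0 : 0 ≤ nsq u := nsq_nonneg u
  have hd : (0 : ℝ) ≤ d := Nat.cast_nonneg d
  have hl1 := sq_mul_ell1_sq_le hn
  have hl2 := pow4_mul_ell2_sq_le hn
  -- first factor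
  have h1 : Real.sqrt (2 * energy (fine n M) ((n : ℕ) : ℂ) u + 2 * d * (n : ℝ) ^ 2 * ell1 n ^ 2 * nsq u) ≤ Ks1 d a' * Real.sqrt W := by
    rw [Ks1, ← Real.sqrt_mul' _ hW0]
    refine Real.sqrt_le_sqrt ?_
    have : 2 * (d : ℝ) * (n : ℝ) ^ 2 * ell1 n ^ 2 * nsq u ≤ 2 * d * 36 * ((gammaPs d a')⁻¹ ^ 2 * W) := by
      have := mul_le_mul hl1 hZ hZ0 (by norm_num)
      nlinarith [this, hd]
    nlinarith [hE, this]
  -- second factor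
  have h2 : Real.sqrt (2 * nsqOn Ω (LapS (fine n M) ((n : ℕ) : ℂ) *ᵥ u) + 16 * d * (n : ℝ) ^ 2 * ell1 n ^ 2 * energy (fine n M) ((n : ℕ) : ℂ) u
        + 4 * d ^ 2 * (n : ℝ) ^ 4 * ell2 n ^ 2 * nsq u) ≤ Ks2 d a' * Real.sqrt W := by
    rw [Ks2, ← Real.sqrt_mul' _ hW0]
    refine Real.sqrt_le_sqrt ?_
    have hA : 16 * (d : ℝ) * (n : ℝ) ^ 2 * ell1 n ^ 2 * energy (fine n M) ((n : ℕ) : ℂ) u ≤ 16 * d * 36 * ((gammaPs d a')⁻¹ * W) := by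
      have := mul_le_mul hl1 hE hE0 (by norm_num)
      nlinarith [this, hd]
    have hB : 4 * (d : ℝ) ^ 2 * (n : ℝ) ^ 4 * ell2 n ^ 2 * nsq u ≤ 4 * d ^ 2 * 2304 * ((gammaPs d a')⁻¹ ^ 2 * W) := by
      have := mul_le_mul hl2 hZ hZ0 (by norm_num)
      nlinarith [this, sq_nonneg (d : ℝ)]
    nlinarith [hG, hA, hB]
  have hK1 := Ks1_nonneg d a'
  have hK2 := Ks2_nonneg d a'
  have hsW : Real.sqrt W * Real.sqrt W = W := Real.mul_self_sqrt hW0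
  calc 24 * 2 ^ d * (n : ℝ) * Real.sqrt (2 * energy (fine n M) ((n : ℕ) : ℂ) u + 2 * d * (n : ℝ) ^ 2 * ell1 n ^ 2 * nsq u)
        * Real.sqrt (2 * nsqOn Ω (LapS (fine n M) ((n : ℕ) : ℂ) *ᵥ u) + 16 * d * (n : ℝ) ^ 2 * ell1 n ^ 2 * energy (fine n M) ((n : ℕ) : ℂ) u
            + 4 * d ^ 2 * (n : ℝ) ^ 4 * ell2 n ^ 2 * nsq u)
      ≤ 24 * 2 ^ d * (n : ℝ) * (Ks1 d a' * Real.sqrt W) * (Ks2 d a' * Real.sqrt W) := by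
        apply mul_le_mul (mul_le_mul_of_nonneg_left h1 (by positivity)) h2 (Real.sqrt_nonneg _)
        positivity
    _ = 24 * 2 ^ d * n * Ks1 d a' * Ks2 d a' * W := by
        rw [show 24 * 2 ^ d * (n : ℝ) * (Ks1 d a' * Real.sqrt W) * (Ks2 d a' * Real.sqrt W)
          = 24 * 2 ^ d * n * Ks1 d a' * Ks2 d a' * (Real.sqrt W * Real.sqrt W) by ring, hsW]

end OneLevel

/-! ## §2 THE END: the two-level injected law on locally splittable unions of unit blocks -/

/-- **the two-level constant of the localised route** `splitConst = 2d·√(24·2^d·γ′⁻¹·Ks₁·Ks₂)`. [folklore] -/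
def splitConst (d : ℕ) (a' : ℝ) : ℝ := 2 * d * Real.sqrt (24 * 2 ^ d * (gammaPs d a')⁻¹ * Ks1 d a' * Ks2 d a')

/-- `splitConst ≥ 0`. [folklore] -/
theorem splitConst_nonneg (d : ℕ) (a' : ℝ) : 0 ≤ splitConst d a' := by unfold splitConst; positivity

section TwoLevel

variable (N R : ℕ) [NeZero N] [NeZero R] (M : Fin d → ℕ) [hM : ∀ μ, NeZero (M μ)] (S : Tor M → Prop) [DecidablePred S]

/-- **THE DIRICHLET TWO-LEVEL INJECTED LAW ON A LOCALLY SPLITTABLE UNION OF UNIT BLOCKS** (U = 1 scalar model, no displayed binder):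
`‖(D′^{Ω′})⁻¹·J^Ω − J^Ω·(D^Ω)⁻¹‖ ≤ splitConst(d, a′)·√R/√N` for `Ω = blockReg N M S`, `Ω′ = refineR N R M Ω` — the owner's wall
`hinj` ∕ gan24-p2's M-E shape, on every locally splittable `S`, at the geometric rate `θ = L^{−1/2}` along `N = L^k`, `R = L`. [folklore] -/
theorem injected_le_of_locallySplittable (hS : LocallySplittable M S) (hN : 1 ≤ N) (hRN : 2 ≤ R * N) {a' : ℝ} (ha' : 0 < a') :
    ‖(DOm (R * N) M a' (refineR N R M (blockReg N M S)))⁻¹ * JOm N R M (blockReg N M S)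
        - JOm N R M (blockReg N M S) * (DOm N M a' (blockReg N M S))⁻¹‖
      ≤ splitConst d a' * Real.sqrt R / Real.sqrt N := by
  have hγ := (gammaPs_pos (d := d) (a' := a')).1
  have hNpos : 0 < (N : ℝ) := by exact_mod_cast hN
  have hRpos : 0 < (R : ℝ) := by exact_mod_cast Nat.pos_of_ne_zero (NeZero.ne R)
  have hK1 := Ks1_nonneg d a'
  have hK2 := Ks2_nonneg d a'
  have hB := splitConst_nonneg d a'
  set Ω := blockReg N M S with hΩ
  have hΩ' : ∀ x, refineR N R M Ω x ↔ S (blockOf (R * N) M x) := fun x => refineR_blockReg_iff N R M S x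
  refine opNorm_le_of_pairing _ (by positivity) fun w f => ?_
  rw [form_defect N R M a' Ω ha' w f]
  set v := solExt (R * N) M a' (refineR N R M Ω) w with hv
  set u := solExt N M a' Ω f with hu
  refine (norm_pairing_le N R M hN u v).trans ?_
  set A : ℝ := 24 * 2 ^ d with hA
  have hsum : ∀ μ : Fin d, Real.sqrt (nsq (sdiff (fine N M) (N : ℂ) μ *ᵥ u))
        * Real.sqrt (nsq (Pdir (fine (R * N) M) ((R * N : ℕ) : ℂ) μ *ᵥ v))
      ≤ (Real.sqrt ((gammaPs d a')⁻¹) * Real.sqrt (nsq f))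
        * (Real.sqrt (A * ((R * N : ℕ) : ℝ) * Ks1 d a' * Ks2 d a') * Real.sqrt (nsq w)) := by
    intro μ
    refine mul_le_mul ?_ ?_ (Real.sqrt_nonneg _) (by positivity)
    · rw [← Real.sqrt_mul (inv_nonneg.mpr hγ.le)]
      exact Real.sqrt_le_sqrt (nsq_sdiff_solExt_le N M a' Ω ha' f μ)
    · rw [← Real.sqrt_mul (by positivity)]
      refine Real.sqrt_le_sqrt ?_
      have h := nsq_Pdir_solExt_le_of_splittable (R * N) M a' (refineR N R M Ω) hRN ha' hΩ' (fun v => hS v μ) w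
      rw [hA]; push_cast at h ⊢; linarith
  have hcast : ((R * N : ℕ) : ℝ) = (R : ℝ) * N := by push_cast; ring
  calc 2 / (N : ℝ) * ∑ μ, Real.sqrt (nsq (sdiff (fine N M) (N : ℂ) μ *ᵥ u))
          * Real.sqrt (nsq (Pdir (fine (R * N) M) ((R * N : ℕ) : ℂ) μ *ᵥ v))
      ≤ 2 / (N : ℝ) * ∑ _μ : Fin d, (Real.sqrt ((gammaPs d a')⁻¹) * Real.sqrt (nsq f))
          * (Real.sqrt (A * ((R * N : ℕ) : ℝ) * Ks1 d a' * Ks2 d a') * Real.sqrt (nsq w)) :=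
        mul_le_mul_of_nonneg_left (Finset.sum_le_sum fun μ _ => hsum μ) (by positivity)
    _ = splitConst d a' * Real.sqrt R / Real.sqrt N * Real.sqrt (nsq w) * Real.sqrt (nsq f) := by
        rw [Finset.sum_const, Finset.card_univ, Fintype.card_fin, nsmul_eq_mul, splitConst, hcast, ← hA]
        have hA0 : 0 ≤ A := by rw [hA]; positivity
        have hsN : Real.sqrt (N : ℝ) ≠ 0 := (Real.sqrt_pos.mpr hNpos).ne'
        have h8 : Real.sqrt (A * ((R : ℝ) * N) * Ks1 d a' * Ks2 d a')
            = Real.sqrt (A * Ks1 d a' * Ks2 d a') * Real.sqrt R * Real.sqrt N := by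
          rw [← Real.sqrt_mul (by positivity), ← Real.sqrt_mul (by positivity)]; ring_nf
        have hg : Real.sqrt (A * (gammaPs d a')⁻¹ * Ks1 d a' * Ks2 d a')
            = Real.sqrt ((gammaPs d a')⁻¹) * Real.sqrt (A * Ks1 d a' * Ks2 d a') := by
          rw [← Real.sqrt_mul (inv_nonneg.mpr hγ.le)]; ring_nf
        have hinv : 2 / (N : ℝ) * Real.sqrt N = 2 / Real.sqrt N := by
          rw [div_mul_eq_mul_div, div_eq_div_iff hNpos.ne' hsN, mul_assoc, Real.mul_self_sqrt hNpos.le]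
        rw [h8, hg]
        calc 2 / (N : ℝ) * ((d : ℝ) * (Real.sqrt ((gammaPs d a')⁻¹) * Real.sqrt (nsq f)
              * (Real.sqrt (A * Ks1 d a' * Ks2 d a') * Real.sqrt R * Real.sqrt N * Real.sqrt (nsq w))))
            = (2 / (N : ℝ) * Real.sqrt N) * ((d : ℝ) * (Real.sqrt ((gammaPs d a')⁻¹) * Real.sqrt (nsq f))
              * (Real.sqrt (A * Ks1 d a' * Ks2 d a') * Real.sqrt R * Real.sqrt (nsq w))) := by ring
          _ = 2 * d * (Real.sqrt ((gammaPs d a')⁻¹) * Real.sqrt (A * Ks1 d a' * Ks2 d a')) * Real.sqrt R / Real.sqrt N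
              * Real.sqrt (nsq w) * Real.sqrt (nsq f) := by rw [hinv]; ring

/-- consistency with gen 3: the law on every LOCALLY MONOTONE block set, re-derived through `locallySplittable_of_locallyMonotone`
(gen 3's `injected_le_of_locallyMonotone` has the constant `besovConst d a′ 6 48` instead). [folklore] -/
theorem injected_le_of_locallyMonotone' (hS : LocallyMonotone M S) (hN : 1 ≤ N) (hRN : 2 ≤ R * N) {a' : ℝ} (ha' : 0 < a') :
    ‖(DOm (R * N) M a' (refineR N R M (blockReg N M S)))⁻¹ * JOm N R M (blockReg N M S)
        - JOm N R M (blockReg N M S) * (DOm N M a' (blockReg N M S))⁻¹‖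
      ≤ splitConst d a' * Real.sqrt R / Real.sqrt N :=
  injected_le_of_locallySplittable N R M S (locallySplittable_of_locallyMonotone M hS) hN hRN ha'

/-- **the checkable criterion**: the law holds whenever at every vertex and axis the patch of `S` is downward-closed, upward-closed OR
pillar-free (file 1's `locallySplittable_of_monotone_or_pillarFree`). [folklore] -/
theorem injected_le_of_monotone_or_pillarFree
    (hS : ∀ v μ, DownClosed M S v μ ∨ UpClosed M S v μ ∨ PillarFree M S v μ) (hN : 1 ≤ N) (hRN : 2 ≤ R * N) {a' : ℝ} (ha' : 0 < a') :
    ‖(DOm (R * N) M a' (refineR N R M (blockReg N M S)))⁻¹ * JOm N R M (blockReg N M S)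
        - JOm N R M (blockReg N M S) * (DOm N M a' (blockReg N M S))⁻¹‖
      ≤ splitConst d a' * Real.sqrt R / Real.sqrt N :=
  injected_le_of_locallySplittable N R M S (locallySplittable_of_monotone_or_pillarFree M hS) hN hRN ha'

end TwoLevel

/-! ## §3 THE TOWER: the Ω-restricted scalar free tower of a locally splittable region, no displayed binder -/

section Tower

variable (L : ℕ) [NeZero L] (M : Fin d → ℕ) [hM : ∀ μ, NeZero (M μ)] (a' : ℝ) (S : Tor M → Prop) [DecidablePred S]

/-- §2's END at every level `(N, R) = (n_k, L)`, in road P2's spelling (the shape the owner's adapter consumes). [folklore] -/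
theorem injected_le_splittable_levels (hS : LocallySplittable M S) (hL : 2 ≤ L) (ha' : 0 < a') (k : ℕ) :
    ‖(DOm (L * lev L k) M a' (refineR (lev L k) L M (blockReg (lev L k) M S)))⁻¹ * JOm (lev L k) L M (blockReg (lev L k) M S)
        - JOm (lev L k) L M (blockReg (lev L k) M S) * (DOm (lev L k) M a' (blockReg (lev L k) M S))⁻¹‖
      ≤ splitConst d a' * Real.sqrt (L : ℝ) / Real.sqrt ((lev L k : ℕ) : ℝ) :=
  injected_le_of_locallySplittable (lev L k) L M S hS (one_le_lev' L k) (two_le_mul_lev L hL k) ha'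

/-- **`hinjS` IS A THEOREM ON EVERY LOCALLY SPLITTABLE UNION OF UNIT BLOCKS**, at the geometric rate `(√L)⁻¹`:
`‖(DsR (k+1))⁻¹·JsR k − JsR k·(DsR k)⁻¹‖ ≤ splitConst d a′ · √L · ((√L)⁻¹)^k` for the tower generated by `Ω₀ = blockReg (lev L 0) M S`.
[folklore] -/
theorem injected_le_splittable_lev (hS : LocallySplittable M S) (hL : 2 ≤ L) (ha' : 0 < a') (k : ℕ) :
    ‖(DsR L M a' (blockReg (lev L 0) M S) (k + 1))⁻¹ * JsR L M (blockReg (lev L 0) M S) k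
        - JsR L M (blockReg (lev L 0) M S) k * (DsR L M a' (blockReg (lev L 0) M S) k)⁻¹‖
      ≤ splitConst d a' * Real.sqrt (L : ℝ) * (Real.sqrt (L : ℝ))⁻¹ ^ k := by
  have h := injected_regS_le_of_blockReg L M a' S (injected_le_splittable_levels L M a' S hS hL ha') k
  rw [sqrt_lev, div_eq_mul_inv, ← inv_pow] at h
  exact h

/-- **THE Ω-RESTRICTED SCALAR FREE TOWER LAWS ON A LOCALLY SPLITTABLE UNION OF UNIT BLOCKS — no displayed binder** (`U = 1`, `L ≥ 2`,
`d ≥ 1`, `a′ > 0`): every field of `FreeTowerLaws` for [B9] (3.24)'s `Ω₀Δ′_aΩ₀` at `U = 1` along `n_k = L^k`, the injected law supplied by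
this route. [cite: Balaban1985BackgroundPropagators, p.394 (3.24) (η-uniform kind only; the rate is ours)] [folklore] -/
theorem freeTowerLaws_dirichletScalar_splittable (hL : 2 ≤ L) (hd : 0 < d) (ha' : 0 < a') (hS : LocallySplittable M S) :
    FreeTowerLaws (DsR L M a' (blockReg (lev L 0) M S)) (QsR L M (blockReg (lev L 0) M S)) (JsR L M (blockReg (lev L 0) M S))
      (fun _ => 0) ((L : ℝ) ^ d) (fun k => 2 * d * Real.sqrt ((gammaPs d a')⁻¹) * ((L : ℝ)⁻¹) ^ k)
      (fun k => splitConst d a' * Real.sqrt (L : ℝ) * (Real.sqrt (L : ℝ))⁻¹ ^ k) (fun _ => 0) :=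
  freeTowerLaws_dirichletScalar_of_injected L M a' (blockReg (lev L 0) M S) hd ha' (injected_le_splittable_lev L M a' S hS hL ha')

/-- **THE Ω-RESTRICTED UNIT-LATTICE SCALAR FREE COVARIANCES OF A LOCALLY SPLITTABLE REGION CONVERGE AT THE RATE `(√L)⁻¹`** (`L ≥ 2`,
`d ≥ 1`, `a′ > 0`) — UNCONDITIONAL: on boxes, re-entrant locally monotone configurations, separated unions AND the new single-component
configurations (face-connected rings closing on themselves through a corner ∕ edge contact). ONE `exact` into the owner's
`towerLimitRate_dirichletScalar_of_sqrt_levels`. [cite: King1986, Lemma 4.5 (4.38) p.674 (shape); Balaban1985BackgroundPropagators,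
p.394 (3.24)] [folklore] -/
theorem towerLimitRate_dirichletScalar_splittable (hL : 2 ≤ L) (hd : 0 < d) (ha' : 0 < a') (hS : LocallySplittable M S) :
    TowerLimitRate (QsR L M (blockReg (lev L 0) M S)) ((L : ℝ) ^ d) (fun k => (DsR L M a' (blockReg (lev L 0) M S) k)⁻¹)
      (Cpert 0 (2 * d * Real.sqrt ((gammaPs d a')⁻¹)) (splitConst d a' * Real.sqrt (L : ℝ)) 0 0 0) ((Real.sqrt (L : ℝ))⁻¹) :=
  towerLimitRate_dirichletScalar_of_sqrt_levels L M a' S hL hd ha' (injected_le_splittable_levels L M a' S hS hL ha')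

/-- **THE RESOLVENT ROUTE OVER A LOCALLY SPLITTABLE REGION**: for every compressed perturbation family `P` with
`PerturbationLaws (DsR …) P (JsR …) κ (k ↦ C₂(√L)^{−k})` and every `‖t‖κ < 1`, the Ω-restricted perturbed scalar covariances converge at
the rate `(√L)⁻¹` — only the perturbation laws are displayed. [folklore] -/
theorem towerLimitRate_dirichletScalar_splittable_perturbed (hL : 2 ≤ L) (hd : 0 < d) (ha' : 0 < a') (hS : LocallySplittable M S)
    {P : (k : ℕ) → Matrix (sidx L M (blockReg (lev L 0) M S) k) (sidx L M (blockReg (lev L 0) M S) k) ℂ} {κ C₂ : ℝ}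
    (hpert : PerturbationLaws (DsR L M a' (blockReg (lev L 0) M S)) P (JsR L M (blockReg (lev L 0) M S)) κ
      (fun k => C₂ * ((Real.sqrt (L : ℝ))⁻¹) ^ k)) {t : ℂ} (ht : ‖t‖ * κ < 1) :
    TowerLimitRate (QsR L M (blockReg (lev L 0) M S)) ((L : ℝ) ^ d) (fun k => (DsR L M a' (blockReg (lev L 0) M S) k + t • P k)⁻¹)
      (Cpert κ (2 * d * Real.sqrt ((gammaPs d a')⁻¹)) (splitConst d a' * Real.sqrt (L : ℝ)) C₂ 0 t) ((Real.sqrt (L : ℝ))⁻¹) :=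
  towerLimitRate_dirichletScalar_perturbed L M a' (blockReg (lev L 0) M S) hd ha' (invL_le_inv_sqrt L (le_trans one_le_two hL))
    (inv_sqrt_lt_one L hL) (injected_le_splittable_lev L M a' S hS hL ha') hpert ht

/-- **THE ZEROTH-ORDER (POTENTIAL) TIER OVER A LOCALLY SPLITTABLE REGION**, rate `(√L)⁻¹`, no free-tower binder: for a potential family with
`‖W^{(k)}(x)‖ ≤ α`, `‖W^{(k+1)}(y) − W^{(k)}(par y)‖ ≤ β/n_k` and a coupling `‖t‖·αγ′⁻¹ < 1`, the unit-lattice covariances of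
`(Ω₀(−Δ + a′Π′)Ω₀ + t·diag(W^{(k)})_{ΩΩ})⁻¹` converge (the owner's O12-f `towerLimitRate_dirichletScalar_potential_of_injected` BY NAME). [folklore] -/
theorem towerLimitRate_dirichletScalar_splittable_potential (hL : 2 ≤ L) (hd : 0 < d) (ha' : 0 < a') (hS : LocallySplittable M S)
    {W : (k : ℕ) → (Tor (fine (lev L k) M) → ℂ)} {α β : ℝ} (hα : 0 ≤ α) (hβ : 0 ≤ β) (hW : ∀ k x, ‖W k x‖ ≤ α)
    (hW' : ∀ k (y : Tor (fine (lev L (k + 1)) M)), ‖W (k + 1) y - W k (par (lev L k) L M y)‖ ≤ β / (lev L k : ℕ))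
    {t : ℂ} (ht : ‖t‖ * (α * (gammaPs d a')⁻¹) < 1) :
    TowerLimitRate (QsR L M (blockReg (lev L 0) M S)) ((L : ℝ) ^ d)
      (fun k => (DsR L M a' (blockReg (lev L 0) M S) k + t • diagS L M (blockReg (lev L 0) M S) W k)⁻¹)
      (Cpert (α * (gammaPs d a')⁻¹) (2 * d * Real.sqrt ((gammaPs d a')⁻¹)) (splitConst d a' * Real.sqrt (L : ℝ))
        ((gammaPs d a')⁻¹ * β * (gammaPs d a')⁻¹) 0 t) ((Real.sqrt (L : ℝ))⁻¹) :=
  towerLimitRate_dirichletScalar_potential_of_injected L M a' (blockReg (lev L 0) M S) hd ha'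
    (invL_le_inv_sqrt L (le_trans one_le_two hL)) (inv_sqrt_lt_one L hL) (injected_le_splittable_lev L M a' S hS hL ha')
    hα hβ hW hW' ht

/-- **the criterion form of the tower END**: convergence at the rate `(√L)⁻¹` whenever at every vertex and axis the patch of `S` is
downward-closed, upward-closed OR pillar-free. [folklore] -/
theorem towerLimitRate_dirichletScalar_of_monotone_or_pillarFree (hL : 2 ≤ L) (hd : 0 < d) (ha' : 0 < a')
    (hS : ∀ v μ, DownClosed M S v μ ∨ UpClosed M S v μ ∨ PillarFree M S v μ) :
    TowerLimitRate (QsR L M (blockReg (lev L 0) M S)) ((L : ℝ) ^ d) (fun k => (DsR L M a' (blockReg (lev L 0) M S) k)⁻¹)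
      (Cpert 0 (2 * d * Real.sqrt ((gammaPs d a')⁻¹)) (splitConst d a' * Real.sqrt (L : ℝ)) 0 0 0) ((Real.sqrt (L : ℝ))⁻¹) :=
  towerLimitRate_dirichletScalar_splittable L M a' S hL hd ha' (locallySplittable_of_monotone_or_pillarFree M hS)

/-- consistency with gen 3's `towerLimitRate_dirichletScalar_monotone` (same rate, this route's constant). [folklore] -/
theorem towerLimitRate_dirichletScalar_monotone'' (hL : 2 ≤ L) (hd : 0 < d) (ha' : 0 < a') (hS : LocallyMonotone M S) :
    TowerLimitRate (QsR L M (blockReg (lev L 0) M S)) ((L : ℝ) ^ d) (fun k => (DsR L M a' (blockReg (lev L 0) M S) k)⁻¹)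
      (Cpert 0 (2 * d * Real.sqrt ((gammaPs d a')⁻¹)) (splitConst d a' * Real.sqrt (L : ℝ)) 0 0 0) ((Real.sqrt (L : ℝ))⁻¹) :=
  towerLimitRate_dirichletScalar_splittable L M a' S hL hd ha' (locallySplittable_of_locallyMonotone M hS)

end Tower

end Summit.QuantumFields.BalabanUV.T4Continuum.DirichletSplittableTwoLevel

end
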